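import Summits.Ventures.PercRepro.C041CycleDict
import Summits.Ventures.PercRepro.C041TriangleZone
import Summits.Ventures.PercRepro.C041CycleRelaxed
import Summits.Ventures.PercRepro.C041TriangleMixedFamily
import Summits.Ventures.PercRepro.C041CycleMarksCone

/-!
# ROW C-041 — THE TWO-EXIT CYCLE ON THE GRAPH MODEL: (P), the one-anchor (CS), the ZONE O-CUBE and the cone, by
name (p6, gen 31; the consequences of THE CYCLE DICTIONARY `sixVec_cyc2` of `C041CycleDict` for mine-3's theorems
on `thetaCyc`)

`cyc2 n i j Z a Z' a'` is the cycle `C_{n+1}` through the anchor `0` with the zone `Z` hung at `x_i` and `Z'` at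
`x_j` (`0 < i < j`), and its six-vector IS `thetaCyc (2^ℓ₁ − 2) (2^ℓ₂ − 2) (2^ℓ₃ − 2) (Π Z) (Π Z')`.  Hence, on
the graph model, for EVERY cycle length and EVERY pair of exit positions:

* two CONE inputs give (P), the one-anchor (CS) and the ZONE O-CUBE on the cycle zone
  (`K4v_sixVec_cyc2_of_inCone`, `zoneCSConj_cyc2_of_inCone`, `zoneOCubeConj_cyc2_of_inCone`; mine-3's
  `K4v_thetaCyc_lengths`, `C041CycleRelaxed`), likewise two members of the class `IsZe`
  (`zoneOCubeConj_cyc2_of_isZe`);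
* **THEOREM (CYCLES WITH TWO MARKED VERTICES), graph-model form**: the cycle carrying `p` / `q` marks at `x_i`
  and `p'` / `q'` marks at `x_j` is IN THE CONE (`inCone_sixVec_cyc2_point`, from mine-3's
  `InCone_thetaCyc_marks_lengths` of `C041TriangleMixedFamily`), hence satisfies the ZONE O-CUBE and the
  one-anchor (CS) (`zoneOCubeConj_cyc2_point`, `zoneCSConj_cyc2_point`) — with no hypothesis;
* **the cycle reduces to the triangle**: with two cone inputs, cone membership of the triangle zone gives cone
  membership of every cycle zone on the same two zones (`inCone_sixVec_cyc2_of_tri2`; mine-3's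
  `InCone_thetaCyc_of_InCone_tri`).
-/

namespace PercRepro

namespace ZoneZ

namespace TwoExit

open ZoneData TreeClosure RelaxedTriangle Finset

variable (n : ℕ) (i j : Fin (n + 1))
variable {V E T₁ T₂ V' E' T₁' T₂' : Type} (Z : ZoneData V E T₁ T₂) (a : V) (Z' : ZoneData V' E' T₁' T₂') (a' : V')
variable [Fintype E] [DecidableEq E] [Fintype T₁] [DecidableEq T₁] [Fintype T₂] [DecidableEq T₂] [Fintype E']
  [DecidableEq E'] [Fintype T₁'] [DecidableEq T₁'] [Fintype T₂'] [DecidableEq T₂']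

/-- The three arcs have length `≥ 1`. -/
theorem arc_lengths (hi : 0 < i.val) (hij : i.val < j.val) :
    1 ≤ i.val ∧ 1 ≤ j.val - i.val ∧ 1 ≤ n + 1 - j.val := by
  have := j.is_le
  omega

/-! ## Cone inputs and class members -/

/-- **(P) on the cycle zone** from two cone inputs. -/
theorem K4v_sixVec_cyc2_of_inCone (hi : 0 < i.val) (hij : i.val < j.val) (h : InCone (Z.sixVec a))
    (h' : InCone (Z'.sixVec a')) : K4v ((cyc2 n i j Z a Z' a').sixVec (Sum.inl (Sum.inl 0))) := by
  obtain ⟨h₁, h₂, h₃⟩ := arc_lengths n i j hi hij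
  rw [sixVec_cyc2 n i j Z a Z' a' hi hij]
  exact K4v_thetaCyc_lengths h h' _ _ _ h₁ h₂ h₃

/-- The one-anchor (CS) on the cycle zone from two cone inputs. -/
theorem zoneCSConj_cyc2_of_inCone (hi : 0 < i.val) (hij : i.val < j.val) (h : InCone (Z.sixVec a))
    (h' : InCone (Z'.sixVec a')) :
    (cyc2 n i j Z a Z' a').ZoneCSConj {Sum.inl (Sum.inl 0)} (∅ : Set ((Fin (n + 1) ⊕ V') ⊕ V)) :=
  (cyc2 n i j Z a Z' a').zoneCSConj_of_K4v_sixVec _ (K4v_sixVec_cyc2_of_inCone n i j Z a Z' a' hi hij h h')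

/-- **The ZONE O-CUBE on the cycle zone** from two cone inputs. -/
theorem zoneOCubeConj_cyc2_of_inCone (hi : 0 < i.val) (hij : i.val < j.val) (h : InCone (Z.sixVec a))
    (h' : InCone (Z'.sixVec a')) :
    (cyc2 n i j Z a Z' a').ZoneOCubeConj {Sum.inl (Sum.inl 0)} (∅ : Set ((Fin (n + 1) ⊕ V') ⊕ V)) :=
  (cyc2 n i j Z a Z' a').zoneOCubeConj_of_K4v_sixVec _ (K4v_sixVec_cyc2_of_inCone n i j Z a Z' a' hi hij h h')

/-- The ZONE O-CUBE on the cycle zone with two members of the class `IsZe` at its exits. -/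
theorem zoneOCubeConj_cyc2_of_isZe (hi : 0 < i.val) (hij : i.val < j.val) (h : IsZe Z a) (h' : IsZe Z' a') :
    (cyc2 n i j Z a Z' a').ZoneOCubeConj {Sum.inl (Sum.inl 0)} (∅ : Set ((Fin (n + 1) ⊕ V') ⊕ V)) :=
  zoneOCubeConj_cyc2_of_inCone n i j Z a Z' a' hi hij (h.inCone _ _ _ _ _ _) (h'.inCone _ _ _ _ _ _)

/-! ## Two marked vertices -/

open PointZone in
/-- **The cycle with two marked vertices of any marks is IN THE CONE**: `p` / `q` marks at `x_i`, `p'` / `q'` at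
`x_j`, any length, any positions. -/
theorem inCone_sixVec_cyc2_point (hi : 0 < i.val) (hij : i.val < j.val) (p q p' q' : ℕ) :
    InCone ((cyc2 n i j (pointZone p q) () (pointZone p' q') ()).sixVec (Sum.inl (Sum.inl 0))) := by
  obtain ⟨h₁, h₂, h₃⟩ := arc_lengths n i j hi hij
  rw [sixVec_cyc2 n i j _ _ _ _ hi hij, sixVec_pointZone, sixVec_pointZone, one_mul, one_mul]
  exact InCone_thetaCyc_marks_lengths p q p' q' _ _ _ h₁ h₂ h₃

open PointZone in
/-- **THEOREM (CYCLES WITH TWO MARKED VERTICES), on the graph model**: the ZONE O-CUBE holds on every cycle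
through the anchor carrying two marked vertices of any marks. -/
theorem zoneOCubeConj_cyc2_point (hi : 0 < i.val) (hij : i.val < j.val) (p q p' q' : ℕ) :
    (cyc2 n i j (pointZone p q) () (pointZone p' q') ()).ZoneOCubeConj {Sum.inl (Sum.inl 0)}
      (∅ : Set ((Fin (n + 1) ⊕ Unit) ⊕ Unit)) :=
  (cyc2 n i j (pointZone p q) () (pointZone p' q') ()).zoneOCubeConj_of_inCone_sixVec _
    (inCone_sixVec_cyc2_point n i j hi hij p q p' q')

open PointZone in
/-- The one-anchor (CS) on every cycle with two marked vertices. -/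
theorem zoneCSConj_cyc2_point (hi : 0 < i.val) (hij : i.val < j.val) (p q p' q' : ℕ) :
    (cyc2 n i j (pointZone p q) () (pointZone p' q') ()).ZoneCSConj {Sum.inl (Sum.inl 0)}
      (∅ : Set ((Fin (n + 1) ⊕ Unit) ⊕ Unit)) :=
  (cyc2 n i j (pointZone p q) () (pointZone p' q') ()).zoneCSConj_of_inCone_sixVec _
    (inCone_sixVec_cyc2_point n i j hi hij p q p' q')

/-! ## The cycle reduces to the triangle, on the graph model -/

/-- **Every two-exit cycle is in the cone as soon as its triangle is**: for two cone inputs, cone membership of the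
triangle zone `tri2 Z a Z' a'` gives cone membership of every cycle zone `cyc2 n i j Z a Z' a'` (mine-3's
`InCone_thetaCyc_of_InCone_tri`, `C041CycleMarksCone`, through the two dictionaries). -/
theorem inCone_sixVec_cyc2_of_tri2 (hi : 0 < i.val) (hij : i.val < j.val) (h : InCone (Z.sixVec a))
    (h' : InCone (Z'.sixVec a')) (ht : InCone ((tri2 Z a Z' a').sixVec (Sum.inl (Sum.inl 0)))) :
    InCone ((cyc2 n i j Z a Z' a').sixVec (Sum.inl (Sum.inl 0))) := by
  obtain ⟨h₁, h₂, h₃⟩ := arc_lengths n i j hi hij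
  rw [sixVec_tri2] at ht
  rw [sixVec_cyc2 n i j Z a Z' a' hi hij]
  exact InCone_thetaCyc_of_InCone_tri h h' ht (mixed_mult_nonneg _ h₁) (mixed_mult_nonneg _ h₂)
    (mixed_mult_nonneg _ h₃)

/-- The ZONE O-CUBE on every two-exit cycle whose triangle is in the cone (cone inputs). -/
theorem zoneOCubeConj_cyc2_of_tri2 (hi : 0 < i.val) (hij : i.val < j.val) (h : InCone (Z.sixVec a))
    (h' : InCone (Z'.sixVec a')) (ht : InCone ((tri2 Z a Z' a').sixVec (Sum.inl (Sum.inl 0)))) :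
    (cyc2 n i j Z a Z' a').ZoneOCubeConj {Sum.inl (Sum.inl 0)} (∅ : Set ((Fin (n + 1) ⊕ V') ⊕ V)) :=
  (cyc2 n i j Z a Z' a').zoneOCubeConj_of_inCone_sixVec _ (inCone_sixVec_cyc2_of_tri2 n i j Z a Z' a' hi hij h h' ht)

end TwoExit

end ZoneZ

end PercRepro
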